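import Summits.QuantumFields.YangMills.Theorems.BalabanUVNodesN08GuardReadSet
import Summits.QuantumFields.YangMills.Theorems.UV3AxialLaunderingFreeSlot
import HarnessLib

/-!
# R3 (cell `ym3-torus`, YM₃ on T³ — a ladder RUNG, NOT d = 4, NOT infinite volume, NOT a mass gap, NOT the Clay problem) —
# **(F-M2a) TRAJECTORY SUPPORT FOR THE MUTE CANCELLATION: cone propagation of agreement along two hybrid trajectories, the one-slot form
# `V_{m+1}(t_{m+1}) = L(U)·U(b⁰)·R(U)` along an axial chain, and the restart of a trajectory at an intermediate level (def-free)**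

Width seat `ym3-torus-px8` g13 on crux `stmt-QuantumFields-19936` `UnitScaleTilt.HistoryTailL` (`--supports`, helper; THEOREMS ONLY, 0 `def`, 0 `sorry`,
default heartbeats).  First half of (F-M2) of LEAD ★w1-19936 g12's note `Cruxes/HistoryTailL/HTopBranchExpansion.md` §4 (M) ∕ §4a (v1.2): the SUPPORT lemmas «every
indicator and every top coordinate of `V^{𝐬′}` is a function of `U′` and of `H = L·U(b⁰)·R`».  RECORD CURRENCY: record-independent kinematics of the guarded averaging; read by
no row of the χ record `AlphaInputsT3ACv4RecChi`; nothing of hTop, of the record, of `HistoryTailL` or of rung R3 is proved here.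

LETTERS (RELATIVE heights `i` over the base level `j` — the letters of LEAD's (E)-model socket `UV3BranchExpansionGuardedTower` and of w8's (A₃-concrete); the absolute
families of ✓`UV3BranchExpansionDistortedSet` re-index INTO these by `i ↦ j + i`, which type-checks by `rfl`; everything HYPOTHESIS-SPECIFIED, no definition): the HYBRID
one-step map of a slice `S ⊆ PBond P (j+i+1)` is written inline, as in n08-w3 ∕ w8 ∕ the socket, `fun C => if C ∈ S then avgFun ℰ W C else axialAvg W C` (print's (0.4)
averaging on `S`, the straight transporter off `S`); a TRAJECTORY of the step slices `S i` up to height `N` is a family `V : (i : ℕ) → GaugeField P j G → GaugeField P (j + i) G`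
with `V 0 U = U` (`hV0`) and `V (i+1) U = hyb (S i) (V i U)` for `i < N` (`hVs` — the socket's `hVs` at a fixed history, its slice `univ.filter (⟨⟨i,hi⟩, ·⟩ ∈ s)` being one
such `S i`); «`C` READS `b`» is the loop-word quantifier of ✓`BalabanUVNodesN08GuardReadSet` (`∃ ι st, st ∈ walk (emb C.src) (loopWord …) ∧ st.bond = b`), UNREAD its negation.

CONTENTS.
* §1 one step: `hyb_apply_congr_off` — if `W = W′` off `A ⊆ PBond P k` then the hybrid coordinates at `C` agree whenever `(C ∈ S ↔ C ∈ S′)`, the segment of `C` misses `A`,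
  and (if `C` is guarded) no loop word of `C` reads a bond of `A` (✓`avgFun_congr_of_read`, ✓`axialAvg_congr_of_read_line`); `small_congr_off` (the guard event likewise);
  `measurable_hyb`, ★ `measurable_traj` (trajectories are measurable).
* §2 ★★ `traj_congr_off_cone` — CONE PROPAGATION: two trajectories (step slices `S₁, S₂`, inputs `U₁, U₂`) and a cone `A : (i : ℕ) → Set (PBond P (j + i))`; if the inputs
  agree off `A 0` and, at every height `i < N`, every `C ∉ A (i+1)` has the three properties of §1 w.r.t. `A i`, then `V₁ i U₁ = V₂ i U₂` off `A i` for `i ≤ N`.  The two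
  instances (M) needs: (α) ONE trajectory, input perturbed at the private bottom slot `b⁰ = b 0`, cone = the exit chain `{b i}` (`traj_update_congr_off_chain`); (β) inputs equal,
  step slices differing at ONE site `(κ, c)`, cone = the Dist-tower `{t i}` above `c` (`traj_congr_off_tower`).
* §3 ★★ `exists_oneSlot_of_chain` — THE ONE-SLOT FORM: along an AXIAL chain `b 0 = b⁰, b i = line (b (i+1)) (τ i)` (`i ≤ m`, `b (i+1) ∉ S i`, `b i` unread by `S i`) there are
  measurable `L, R : GaugeField P j G → G`, invariant under `update · b⁰ ·`, with `V (m+1) U (b (m+1)) = L U * U b⁰ * R U` for all `U` — the letter LEAD's engine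
  ✓`UV3BranchExpansionOneSlotField.lintegral_fieldMeasure_oneSlot_eq` consumes (`exists_axialAvg_split`: `Ū(C) = pre·W(line C τ)·post`, nested height by height).
* §4 `traj_eq_restart` — a trajectory is, above height `n`, the trajectory RESTARTED at height `n` from `V n U` (same step slices).

HONEST SCOPE.  [folklore] bookkeeping on lit `AveragingRT`∕`BlockAveraging` objects by import; 0 `def`, 0 `instance`, standard axioms.  NOT here: the exhibit `Ψ` and the
cancellation itself ((F-M2b) `…MuteCancellation`), the lattice facts producing the chain ∕ tower (✓`UV3BranchExpansionDistortedSet.exists_exit_chain`, (F-M1)), any count.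
Nothing of hTop ∕ lemma (M) ∕ the χ record's rows ∕ (O‴χₛ) ∕ `HistoryTailL` (19936) ∕ the rung `YM3TorusSU2` is proved; rung R3 = SU(2) YM₃ on T³ — NOT d = 4, NOT infinite
volume, NOT a mass gap, NOT Clay; the Yang–Mills mass gap is NOT proved.

References: T. Bałaban, Commun. Math. Phys. **109** (1987) 249–301 [Balaban1987RG1] ((0.4) p. 253: the guarded averaging, its read set); T. Bałaban, Commun. Math.
Phys. **95** (1984) 17–40 [Balaban1984PropagatorsI] ((1.7) p. 18, the straight contour); LEAD note `Cruxes/HistoryTailL/HTopBranchExpansion.md` §4∕§4a (F-M2).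
-/

set_option autoImplicit false

noncomputable section

open Function

namespace Summit.QuantumFields.YangMills.Theorems.UV3BranchExpansionTrajectorySupport

open Literature.MathematicalPhysics.QuantumFieldTheory.Balaban1983to89
open Literature.MathematicalPhysics.QuantumFieldTheory.Balaban1983to89.AveragingRT
open Literature.MathematicalPhysics.QuantumFieldTheory.Balaban1983to89.T4Continuum (walk loopWord)
open Literature.MathematicalPhysics.QuantumFieldTheory.Balaban1983to89.BlockAveraging (Idx off Small avgFun)
open Summit.QuantumFields.YangMills.Theorems.BalabanUVNodesN08GuardReadSet (avgFun_congr_of_read small_iff_of_read axialAvg_congr_of_read_line)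
open Summit.QuantumFields.YangMills.Theorems.UV3AxialLaunderingFreeSlot (line_inj)

variable {P : Params} {G : Type*} [GaugeGroup G] (ℰ : LoopAverage G) [∀ k, DecidableEq (PBond P k)]

/-! ## §1 One step: agreement off a set propagates through the hybrid map -/
section OneStep

variable {k : ℕ}

omit [∀ k, DecidableEq (PBond P k)] in
/-- **THE GUARD EVENT READS ONLY THE LOOP-WORD BONDS**: if `W = W′` off `A` and no loop word of `C` reads a bond of `A`, then `Small ℰ W C ↔ Small ℰ W′ C`.
[cite: Balaban1987RG1, (0.4) p.253] -/
theorem small_congr_off (A : Set (PBond P k)) {W W' : GaugeField P k G} (hWW' : ∀ b, b ∉ A → W b = W' b) (C : PBond P (k + 1))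
    (hread : ∀ (ι : Idx P), ∀ st ∈ walk (emb C.src) (loopWord P.L C.dir (off ι.1) ι.2.1 ι.2.2), st.bond ∉ A) :
    Small ℰ W C ↔ Small ℰ W' C :=
  small_iff_of_read ℰ C fun ι st hst => hWW' _ (hread ι st hst)

/-- ★ **ONE-STEP AGREEMENT OFF A SET**: if `W = W′` off `A ⊆ PBond P k`, the hybrid coordinates `hyb S W C` and `hyb S′ W′ C` agree at every `C` which the two slices treat
alike (`C ∈ S ↔ C ∈ S′`), whose segment misses `A`, and — if guarded — whose loop words read no bond of `A`. [cite: Balaban1987RG1, (0.4) p.253] -/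
theorem hyb_apply_congr_off (S S' : Finset (PBond P (k + 1))) (A : Set (PBond P k)) {W W' : GaugeField P k G} (hWW' : ∀ b, b ∉ A → W b = W' b)
    (C : PBond P (k + 1)) (hCS : C ∈ S ↔ C ∈ S') (hline : ∀ t, t < P.L → line C t ∉ A)
    (hread : C ∈ S → ∀ (ι : Idx P), ∀ st ∈ walk (emb C.src) (loopWord P.L C.dir (off ι.1) ι.2.1 ι.2.2), st.bond ∉ A) :
    (if C ∈ S then avgFun ℰ W C else axialAvg W C) = (if C ∈ S' then avgFun ℰ W' C else axialAvg W' C) := by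
  by_cases hC : C ∈ S
  · rw [if_pos hC, if_pos (hCS.1 hC)]
    exact avgFun_congr_of_read ℰ C (fun ι st hst => hWW' _ (hread hC ι st hst)) fun t ht => hWW' _ (hline t ht)
  · rw [if_neg hC, if_neg (fun h => hC (hCS.2 h))]
    exact axialAvg_congr_of_read_line C fun t ht => hWW' _ (hline t ht)

variable [MeasurableSpace G] [RegularGaugeGroup G]

/-- The hybrid one-step map is measurable (measurable small-loop average `E`; n08-w3's `measurable_hybrid`, re-derived to keep the imports light). [folklore] -/
theorem measurable_hyb (hE : ∀ n, Measurable fun W : Fin (n + 1) → G => ℰ.E W) (S : Finset (PBond P (k + 1))) :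
    Measurable fun W : GaugeField P k G => (fun C => if C ∈ S then avgFun ℰ W C else axialAvg W C : GaugeField P (k + 1) G) := by
  refine measurable_pi_lambda _ fun C => ?_
  by_cases hC : C ∈ S
  · simp only [if_pos hC]
    exact (measurable_pi_apply C).comp (BlockAveraging.measurable_avgFun ℰ hE)
  · simp only [if_neg hC]
    exact (measurable_pi_apply C).comp measurable_axialAvg

/-- ★ **TRAJECTORIES ARE MEASURABLE** at every height `i ≤ N`. [folklore] -/
theorem measurable_traj (hE : ∀ n, Measurable fun W : Fin (n + 1) → G => ℰ.E W) {j N : ℕ} (S : (i : ℕ) → Finset (PBond P (j + i + 1)))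
    (V : (i : ℕ) → GaugeField P j G → GaugeField P (j + i) G) (hV0 : ∀ U, V 0 U = U)
    (hVs : ∀ i, i < N → ∀ U, V (i + 1) U = fun C => if C ∈ S i then avgFun ℰ (V i U) C else axialAvg (V i U) C) :
    ∀ i, i ≤ N → Measurable (V i) := by
  intro i hi
  induction i with
  | zero =>
    have : V 0 = id := funext fun U => hV0 U
    rw [this]; exact measurable_id
  | succ i ih =>
    have hi' : i < N := Nat.lt_of_succ_le hi
    have : V (i + 1) = (fun W : GaugeField P (j + i) G => (fun C => if C ∈ S i then avgFun ℰ W C else axialAvg W C : GaugeField P (j + i + 1) G)) ∘ V i :=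
      funext fun U => hVs i hi' U
    rw [this]
    exact (measurable_hyb ℰ hE (S i)).comp (ih hi'.le)

end OneStep

/-! ## §2 Cone propagation along two trajectories -/
section Cone

variable {j N : ℕ}

/-- ★★ **CONE PROPAGATION OF AGREEMENT**: two hybrid trajectories `V₁` (slices `S₁`, input `U₁`) and `V₂` (slices `S₂`, input `U₂`) up to height `N`, and a cone
`A i ⊆ PBond P (j+i)`.  If the inputs agree off `A 0` and for every height `i < N` every bond `C ∉ A (i+1)` is treated alike by the two slices, has its segment outside `A i`,
and (if guarded) reads no bond of `A i`, then `V₁ i U₁ = V₂ i U₂` off `A i` at every height `i ≤ N`.  (The functional-dependence lemma of §4∕§4a of the note, in one induction.)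
[cite: Balaban1987RG1, (0.4) p.253] -/
theorem traj_congr_off_cone (S₁ S₂ : (i : ℕ) → Finset (PBond P (j + i + 1))) (V₁ V₂ : (i : ℕ) → GaugeField P j G → GaugeField P (j + i) G)
    (hV₁0 : ∀ U, V₁ 0 U = U) (hV₂0 : ∀ U, V₂ 0 U = U)
    (hV₁s : ∀ i, i < N → ∀ U, V₁ (i + 1) U = fun C => if C ∈ S₁ i then avgFun ℰ (V₁ i U) C else axialAvg (V₁ i U) C)
    (hV₂s : ∀ i, i < N → ∀ U, V₂ (i + 1) U = fun C => if C ∈ S₂ i then avgFun ℰ (V₂ i U) C else axialAvg (V₂ i U) C)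
    (A : (i : ℕ) → Set (PBond P (j + i))) {U₁ U₂ : GaugeField P j G} (hU : ∀ b, b ∉ A 0 → U₁ b = U₂ b)
    (hstep : ∀ i, i < N → ∀ C : PBond P (j + i + 1), C ∉ A (i + 1) →
      (C ∈ S₁ i ↔ C ∈ S₂ i) ∧ (∀ t, t < P.L → line C t ∉ A i) ∧
        (C ∈ S₁ i → ∀ (ι : Idx P), ∀ st ∈ walk (emb C.src) (loopWord P.L C.dir (off ι.1) ι.2.1 ι.2.2), st.bond ∉ A i)) :
    ∀ i, i ≤ N → ∀ C, C ∉ A i → V₁ i U₁ C = V₂ i U₂ C := by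
  intro i hi
  induction i with
  | zero =>
    intro C hC
    rw [hV₁0, hV₂0]
    exact hU C hC
  | succ i ih =>
    intro C hC
    have hi' : i < N := Nat.lt_of_succ_le hi
    obtain ⟨hCS, hline, hread⟩ := hstep i hi' C hC
    rw [hV₁s i hi', hV₂s i hi']
    exact hyb_apply_congr_off ℰ (S₁ i) (S₂ i) (A i) (ih hi'.le) C hCS hline hread

/-- ★ **INSTANCE (α) — INPUT PERTURBED AT A PRIVATE BOTTOM SLOT**: one trajectory, inputs `U` and `U[b 0 ↦ g]`; along a chain `b i = line (b (i+1)) (τ i)` (`i < N`,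
standing range) whose bonds are UNREAD by the guarded steps (`∀ C ∈ S i`, no loop word of `C` reads `b i`), the two trajectories agree off `{b i}` at every height `i ≤ N`
(a chain bond lies on no other segment, ✓`line_inj`). [cite: Balaban1984PropagatorsI, (1.7) p.18] -/
theorem traj_update_congr_off_chain (S : (i : ℕ) → Finset (PBond P (j + i + 1))) (V : (i : ℕ) → GaugeField P j G → GaugeField P (j + i) G)
    (hV0 : ∀ U, V 0 U = U) (hVs : ∀ i, i < N → ∀ U, V (i + 1) U = fun C => if C ∈ S i then avgFun ℰ (V i U) C else axialAvg (V i U) C)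
    (hN : j + N ≤ P.m + P.K) (b : (i : ℕ) → PBond P (j + i)) (τ : ℕ → ℕ)
    (hchain : ∀ i, i < N → τ i < P.L ∧ b i = line (b (i + 1)) (τ i))
    (hunread : ∀ i, i < N → ∀ C ∈ S i, ∀ (ι : Idx P), ∀ st ∈ walk (emb C.src) (loopWord P.L C.dir (off ι.1) ι.2.1 ι.2.2), st.bond ≠ b i)
    (U : GaugeField P j G) (g : G) :
    ∀ i, i ≤ N → ∀ C, C ≠ b i → V i (update U (b 0) g) C = V i U C := by
  refine traj_congr_off_cone ℰ S S V V hV0 hV0 hVs hVs (fun i => {C | C = b i}) (U₁ := update U (b 0) g) (U₂ := U)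
    (fun C hC => update_of_ne hC g U) fun i hi C hC => ⟨Iff.rfl, ?_, ?_⟩
  · intro t ht hmem
    obtain ⟨hτ, hb⟩ := hchain i hi
    have hmem' : line C t = line (b (i + 1)) (τ i) := by rw [← hb]; exact hmem
    exact hC (line_inj (j := j + i) (show j + i + 1 ≤ P.m + P.K by omega) ht hτ hmem').1
  · intro hCs ι st hst hmem
    exact hunread i hi C hCs ι st hst hmem

/-- ★ **INSTANCE (β) — BRANCH FLIPPED AT ONE SITE**: the same input, slices `S₁, S₂` which agree except possibly at the bond `c` at height `κ`; above `c` a TOWER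
`t (κ+1) = c`, `t i = line (t (i+1)) (τ i)` (`κ+1 ≤ i < N`, standing range) of bonds UNREAD by the guarded steps at their heights.  Then the two trajectories agree everywhere
at the heights `i ≤ κ` and off `{t i}` at the heights `κ+1 ≤ i ≤ N` — the branch value influences nothing but the tower. [cite: Balaban1987RG1, (0.4) p.253] -/
theorem traj_congr_off_tower (S₁ S₂ : (i : ℕ) → Finset (PBond P (j + i + 1))) (V₁ V₂ : (i : ℕ) → GaugeField P j G → GaugeField P (j + i) G)
    (hV₁0 : ∀ U, V₁ 0 U = U) (hV₂0 : ∀ U, V₂ 0 U = U)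
    (hV₁s : ∀ i, i < N → ∀ U, V₁ (i + 1) U = fun C => if C ∈ S₁ i then avgFun ℰ (V₁ i U) C else axialAvg (V₁ i U) C)
    (hV₂s : ∀ i, i < N → ∀ U, V₂ (i + 1) U = fun C => if C ∈ S₂ i then avgFun ℰ (V₂ i U) C else axialAvg (V₂ i U) C)
    {κ : ℕ} (hN : j + N ≤ P.m + P.K) (c : PBond P (j + κ + 1))
    (hs : ∀ i, i ≠ κ → S₁ i = S₂ i) (hsκ : ∀ C : PBond P (j + κ + 1), C ≠ c → (C ∈ S₁ κ ↔ C ∈ S₂ κ))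
    (t : (i : ℕ) → PBond P (j + i)) (τ : ℕ → ℕ) (htc : t (κ + 1) = c)
    (htower : ∀ i, κ + 1 ≤ i → i < N → τ i < P.L ∧ t i = line (t (i + 1)) (τ i))
    (hunread : ∀ i, κ + 1 ≤ i → i < N → ∀ C ∈ S₁ i, ∀ (ι : Idx P), ∀ st ∈ walk (emb C.src) (loopWord P.L C.dir (off ι.1) ι.2.1 ι.2.2), st.bond ≠ t i)
    (U : GaugeField P j G) :
    ∀ i, i ≤ N → ∀ C, (κ + 1 ≤ i → C ≠ t i) → V₁ i U C = V₂ i U C := by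
  have h := traj_congr_off_cone ℰ S₁ S₂ V₁ V₂ hV₁0 hV₂0 hV₁s hV₂s (fun i => {C | κ + 1 ≤ i ∧ C = t i}) (U₁ := U) (U₂ := U) (N := N)
    (fun _ _ => rfl) ?_
  · intro i hi C hC
    exact h i hi C fun hmem => hC hmem.1 hmem.2
  intro i hi C hC'
  have hC : ∀ h1 : κ + 1 ≤ i + 1, C ≠ t (i + 1) := fun h1 h2 => hC' ⟨h1, h2⟩
  refine ⟨?_, ?_, ?_⟩
  · -- the slices treat `C` alike
    by_cases hiκ : i = κ
    · subst hiκ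
      exact hsκ C fun hCc => hC le_rfl (by rw [htc]; exact hCc)
    · rw [hs i hiκ]
  · -- the segment of `C` misses the tower bond `t i`
    intro t' ht' hmem
    obtain ⟨hi1, hmem⟩ := hmem
    obtain ⟨hτ, hti⟩ := htower i hi1 hi
    have hmem' : line C t' = line (t (i + 1)) (τ i) := by rw [← hti]; exact hmem
    exact hC (by omega) (line_inj (j := j + i) (show j + i + 1 ≤ P.m + P.K by omega) ht' hτ hmem').1
  · -- guarded steps do not read the tower
    intro hCs ι st hst hmem
    obtain ⟨hi1, hmem⟩ := hmem
    exact hunread i hi1 hi C hCs ι st hst hmem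

end Cone

/-! ## §3 The one-slot form along an axial chain -/
section OneSlot

variable {k : ℕ}

omit [∀ k, DecidableEq (PBond P k)] in
/-- The partial transports read only the bonds already traversed. [cite: Balaban1984PropagatorsI, (1.7) p.18] -/
theorem pathProd_congr {W W' : GaugeField P k G} (C : PBond P (k + 1)) {n : ℕ} (h : ∀ t, t < n → W (line C t) = W' (line C t)) :
    pathProd W C n = pathProd W' C n := by
  induction n with
  | zero => rfl
  | succ n ih => simp only [pathProd, ih (fun t ht => h t (Nat.lt_succ_of_lt ht)), h n (Nat.lt_succ_self n)]

variable [MeasurableSpace G] [RegularGaugeGroup G]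

omit [∀ k, DecidableEq (PBond P k)] in
/-- **SPLITTING A PARTIAL TRANSPORT AT A SLOT**: for `τ < n`, `pathProd W C n = pathProd W C τ · W (line C τ) · post W` with `post` measurable and reading only the bonds
`line C t`, `τ < t < n`. [cite: Balaban1984PropagatorsI, (1.7) p.18] -/
theorem exists_pathProd_split (C : PBond P (k + 1)) (τ : ℕ) :
    ∀ n, τ < n → ∃ post : GaugeField P k G → G, Measurable post ∧
      (∀ W W' : GaugeField P k G, (∀ t, τ < t → t < n → W (line C t) = W' (line C t)) → post W = post W') ∧
      ∀ W, pathProd W C n = pathProd W C τ * W (line C τ) * post W := by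
  intro n hn
  induction n with
  | zero => exact absurd hn (Nat.not_lt_zero τ)
  | succ n ih =>
    rcases Nat.lt_succ_iff_lt_or_eq.1 hn with hlt | heq
    · obtain ⟨post, hpm, hpr, hpe⟩ := ih hlt
      refine ⟨fun W => post W * W (line C n), hpm.mul (measurable_pi_apply _), ?_, ?_⟩
      · intro W W' h
        exact congrArg₂ (· * ·) (hpr W W' (fun t h1 h2 => h t h1 (Nat.lt_succ_of_lt h2))) (h n hlt (Nat.lt_succ_self n))
      · intro W
        show pathProd W C n * W (line C n) = pathProd W C τ * W (line C τ) * (post W * W (line C n))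
        rw [hpe W, mul_assoc]
    · subst heq
      refine ⟨fun _ => 1, measurable_const, fun _ _ _ => rfl, fun W => ?_⟩
      rw [pathProd, mul_one]

omit [∀ k, DecidableEq (PBond P k)] in
/-- ★ **THE AXIAL AVERAGE SPLIT AT A SLOT**: for `τ < L` there are measurable `pre, post : GaugeField P k G → G` reading only the bonds `line C t`, `t ≠ τ`, `t < L`, with
`Ū(C)(W) = pre W · W (line C τ) · post W` for every `W`. [cite: Balaban1984PropagatorsI, (1.7) p.18] -/
theorem exists_axialAvg_split (C : PBond P (k + 1)) {τ : ℕ} (hτ : τ < P.L) :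
    ∃ pre post : GaugeField P k G → G, Measurable pre ∧ Measurable post ∧
      (∀ W W' : GaugeField P k G, (∀ t, t < P.L → t ≠ τ → W (line C t) = W' (line C t)) → pre W = pre W' ∧ post W = post W') ∧
      ∀ W, axialAvg W C = pre W * W (line C τ) * post W := by
  obtain ⟨post, hpm, hpr, hpe⟩ := exists_pathProd_split (G := G) C τ P.L hτ
  refine ⟨fun W => pathProd W C τ, post, measurable_pathProd C τ, hpm, ?_, fun W => hpe W⟩
  intro W W' h
  exact ⟨pathProd_congr C fun t ht => h t (lt_trans ht hτ) (Nat.ne_of_lt ht), hpr W W' fun t h1 h2 => h t h2 (Nat.ne_of_gt h1)⟩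

variable {j N : ℕ}

/-- ★★ **THE ONE-SLOT FORM ALONG AN AXIAL CHAIN** (the letter LEAD's engine ✓`lintegral_fieldMeasure_oneSlot_eq` consumes).  Let `V` be the trajectory of the slices `S` up to
height `N` and `b 0 = b⁰, b 1, …, b (m+1)` (`m + 1 ≤ N`) a chain with `b i = line (b (i+1)) (τ i)`, `b (i+1) ∉ S i` (AXIAL parents) and `b i` UNREAD by the guarded steps of
height `i` (`i ≤ m`; standing range `j + N ≤ m_P + K_P`).  Then there are measurable `L, R : GaugeField P j G → G`, invariant under `U ↦ U[b⁰ ↦ g]`, with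
**`V (m+1) U (b (m+1)) = L U · U b⁰ · R U`** for every `U` — `U(b⁰)` occurs exactly once in the nested straight transports (each bond lies on at most one segment), every other
factor does not see it. [cite: Balaban1984PropagatorsI, (1.7) p.18; Balaban1987RG1, (0.4) p.253] -/
theorem exists_oneSlot_of_chain (hE : ∀ n, Measurable fun W : Fin (n + 1) → G => ℰ.E W) (S : (i : ℕ) → Finset (PBond P (j + i + 1)))
    (V : (i : ℕ) → GaugeField P j G → GaugeField P (j + i) G) (hV0 : ∀ U, V 0 U = U)
    (hVs : ∀ i, i < N → ∀ U, V (i + 1) U = fun C => if C ∈ S i then avgFun ℰ (V i U) C else axialAvg (V i U) C)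
    (hN : j + N ≤ P.m + P.K) {m : ℕ} (hm : m + 1 ≤ N) (b : (i : ℕ) → PBond P (j + i)) (τ : ℕ → ℕ)
    (hchain : ∀ i, i < m + 1 → τ i < P.L ∧ b i = line (b (i + 1)) (τ i))
    (hax : ∀ i, i < m + 1 → b (i + 1) ∉ S i)
    (hunread : ∀ i, i < m + 1 → ∀ C ∈ S i, ∀ (ι : Idx P), ∀ st ∈ walk (emb C.src) (loopWord P.L C.dir (off ι.1) ι.2.1 ι.2.2), st.bond ≠ b i) :
    ∃ L R : GaugeField P j G → G, Measurable L ∧ Measurable R ∧ (∀ U g, L (update U (b 0) g) = L U) ∧ (∀ U g, R (update U (b 0) g) = R U) ∧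
      ∀ U, V (m + 1) U (b (m + 1)) = L U * U (b 0) * R U := by
  -- agreement off the chain under the perturbation at `b 0` (instance (α) of the cone, run up to height `m + 1`)
  have hcone := traj_update_congr_off_chain ℰ S V hV0 (N := m + 1) (fun i hi U => hVs i (by omega) U) (by omega) b τ hchain hunread
  have hVm := measurable_traj ℰ hE S V hV0 hVs
  -- the claim at every height `n ≤ m+1`, by induction
  suffices H : ∀ n, n ≤ m + 1 → ∃ L R : GaugeField P j G → G, Measurable L ∧ Measurable R ∧
      (∀ U g, L (update U (b 0) g) = L U) ∧ (∀ U g, R (update U (b 0) g) = R U) ∧ ∀ U, V n U (b n) = L U * U (b 0) * R U from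
    H (m + 1) le_rfl
  intro n hn
  induction n with
  | zero =>
    refine ⟨fun _ => 1, fun _ => 1, measurable_const, measurable_const, fun _ _ => rfl, fun _ _ => rfl, fun U => ?_⟩
    rw [hV0, one_mul, mul_one]
  | succ n ih =>
    obtain ⟨L, R, hLm, hRm, hLi, hRi, hLR⟩ := ih (Nat.le_of_succ_le hn)
    have hnm : n < m + 1 := Nat.lt_of_succ_le hn
    obtain ⟨hτ, hb⟩ := hchain n hnm
    obtain ⟨pre, post, hprem, hpostm, hread, hsplit⟩ := exists_axialAvg_split (G := G) (b (n + 1)) hτ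
    have hVn : Measurable (V n) := hVm n (by omega)
    refine ⟨fun U => pre (V n U) * L U, fun U => R U * post (V n U), (hprem.comp hVn).mul hLm, hRm.mul (hpostm.comp hVn), ?_, ?_, ?_⟩
    · -- invariance of the new left factor: the other bonds of the segment are off the chain
      intro U g
      have hoff : ∀ t, t < P.L → t ≠ τ n → V n (update U (b 0) g) (line (b (n + 1)) t) = V n U (line (b (n + 1)) t) := by
        intro t ht htne
        refine hcone U g n hnm.le _ fun hmem => htne ?_
        have hmem' : line (b (n + 1)) t = line (b (n + 1)) (τ n) := by rw [← hb]; exact hmem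
        exact (line_inj (j := j + n) (show j + n + 1 ≤ P.m + P.K by omega) ht hτ hmem').2
      show pre (V n (update U (b 0) g)) * L (update U (b 0) g) = pre (V n U) * L U
      rw [(hread _ _ hoff).1, hLi]
    · intro U g
      have hoff : ∀ t, t < P.L → t ≠ τ n → V n (update U (b 0) g) (line (b (n + 1)) t) = V n U (line (b (n + 1)) t) := by
        intro t ht htne
        refine hcone U g n hnm.le _ fun hmem => htne ?_
        have hmem' : line (b (n + 1)) t = line (b (n + 1)) (τ n) := by rw [← hb]; exact hmem
        exact (line_inj (j := j + n) (show j + n + 1 ≤ P.m + P.K by omega) ht hτ hmem').2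
      show R (update U (b 0) g) * post (V n (update U (b 0) g)) = R U * post (V n U)
      rw [(hread _ _ hoff).2, hRi]
    · -- the factorisation one height up: the parent is axial, split its transport at the chain slot
      intro U
      have hstep : V (n + 1) U (b (n + 1)) = axialAvg (V n U) (b (n + 1)) := by
        rw [hVs n (by omega)]
        show (if b (n + 1) ∈ S n then avgFun ℰ (V n U) (b (n + 1)) else axialAvg (V n U) (b (n + 1))) = _
        rw [if_neg (hax n hnm)]
      rw [hstep, hsplit, ← hb, hLR U]
      simp only [mul_assoc]

end OneSlot

/-! ## §4 Restarting a trajectory at an intermediate height -/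
section Restart

variable {j n N : ℕ}

/-- **RESTART**: a trajectory `V` of the slices `S` up to height `N` and the trajectory `Vup` RESTARTED at height `n` (`Vup i : GaugeField P (j+n) G → GaugeField P (j+(n+i)) G`, same
slices re-indexed) satisfy `V (n + i) U = Vup i (V n U)` for `n + i ≤ N` — everything above height `n` is a function of the height-`n` field. [folklore] -/
theorem traj_eq_restart (S : (i : ℕ) → Finset (PBond P (j + i + 1))) (V : (i : ℕ) → GaugeField P j G → GaugeField P (j + i) G)
    (hVs : ∀ i, i < N → ∀ U, V (i + 1) U = fun C => if C ∈ S i then avgFun ℰ (V i U) C else axialAvg (V i U) C)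
    (Vup : (i : ℕ) → GaugeField P (j + n) G → GaugeField P (j + (n + i)) G) (hVup0 : ∀ W, Vup 0 W = W)
    (hVups : ∀ i, n + i < N → ∀ W, Vup (i + 1) W = fun C => if C ∈ S (n + i) then avgFun ℰ (Vup i W) C else axialAvg (Vup i W) C) :
    ∀ i, n + i ≤ N → ∀ U, V (n + i) U = Vup i (V n U) := by
  intro i hi
  induction i with
  | zero => intro U; rw [hVup0]; rfl
  | succ i ih =>
    intro U
    have hi' : n + i < N := by omega
    have h1 : V (n + (i + 1)) U = V (n + i + 1) U := rfl
    rw [h1, hVs (n + i) hi', hVups i hi', ih hi'.le U]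

end Restart

end Summit.QuantumFields.YangMills.Theorems.UV3BranchExpansionTrajectorySupport

end
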